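import Summits.QuantumFields.YangMills.Theorems.BalabanUVNodesN14SharpTiltDefectChain
import Summits.QuantumFields.YangMills.Theorems.BalabanUVNodesN19ClassSandwichRoad

/-!
# DAG node N14 · NE1′ — THE CALCULUS OF THE U3 FACE FOR N14 (SHAPE_cl IN DENSITY FORM): Radon–Nikodym EQUIVALENCE with n19-c's measure
# sandwich, SYMMETRY in the two runs, TRANSITIVITY along runs (widths add), TILT-INVARIANCE (the `s`-tilted class laws are again in density form with
# the SAME `g` and the same width), PUSH-FORWARD stability, BLOCK PRODUCTS; hence n19-c's MEASURE sandwich SHAPE_cl gives N14's binder at `2B·tanh(r∕2)`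

Cell `pub-ymgap`, YM-PLAN Track A (HUMAN RULING D-0062 ∕ D-0149, director-ym №197), width seat `pub-ymgap-dag-n14-w3` (generation 3).  Director-ym
№195 (8) carries N14 DEPENDENT on §N19 s1 ∕ U3: «U3 ⇒ SHAPE_cl ⇒ N14's binder for every unit-scale observable» (n19-c `N19ClassSandwichRoad` p496221 :258,
n19-e `N19MGFJoinConverse` p497552 :280).  The U3 face SHAPE_cl is TYPED TWICE in the tree — as n19-c's class-level MEASURE sandwich (road (iii) into
`Spine.NE7.Core`: `e^{c − r}·μA ≤ μB ≤ e^{c + r}·μA` as measures, per-class constant `c`) and as the DENSITY form `μB = e^{c}·μA.withDensity e^{g}`,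
`g` measurable, `|g| ≤ r` (n19-c §3, n19-w2's `hSh`∕`hD` in `…N19ShapeFaceN14AtRecord(TV∕Sharp)`, n19-d M27 `…N19DensityRoad.shapeDensity_of_dens`) — with only
the direction density ⇒ sandwich typed (`N19ClassSandwichRoad.shapeSandwich_of_shapeDensity`).  This file types the CALCULUS of that hypothesis shape and closes
the loop, consuming the N19-side typed faces BY NAME:
* §1 ONE PAIR of measures [folklore]: `sandwich_of_shapeDensity` (one-pair reading of n19-c's lemma) · ★★ `exists_shapeDensity_of_sandwich` (Radon–Nikodym:
  a finite `μ` sandwiched AS A MEASURE, `0 ≤ r` ⇒ a measurable log-density `g` with `|g| ≤ r` EVERYWHERE — Mathlib `Measure.rnDeriv`,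
  `ae_le_of_forall_setLIntegral_le_of_sigmaFinite`, a null-set clamp) · `sandwich_symm` · `sandwich_trans` (constants add, widths ADD; density forms
  `shapeDensity_symm` ∕ `shapeDensity_trans`) · ★ `shapeDensity_tilted` (TILT-INVARIANCE: `ν = e^{c}·μ.withDensity e^{g}` ⇒ `ν.tilted f = e^{c′}·(μ.tilted f).withDensity e^{g}` with the
  SAME `g` and `|c′| ≤ r` — Mathlib `Measure.tilted`, `withDensity_mul`) · `sandwich_tilted` (hence `e^{c′ ∓ r}`, and constant-free `e^{∓ 2r}`, between the
  tilted PROBABILITY laws) · `sandwich_map` ∕ `shapeDensity_map` (push-forward along a measurable map keeps the width) · `shapeDensity_prod` (independent blocks: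
  widths add; Mathlib `prod_withDensity`).
* §2 CLASS LEVEL, n19-c's binder prefixes VERBATIM: ★ `shapeDensity_of_shapeSandwich` · `shapeSandwich_iff_shapeDensity` · `shapeSandwich_symm` ·
  `shapeSandwich_trans` (three runs) · ★ `shapeSandwich_tilted` (the U3 face is INHERITED by the `s`-tilted class laws `(μ· K τ).tilted (s·W K)` for EVERY
  real `s`, same width — the located reason SHAPE_cl serves N14's TILTED binder `TiltedMeanMatching` uniformly on the tilt window at a tilt-free rate, whereas the
  TV currency pays the tilt: n19-c `N19CoreTVInvariant.tiltedMeanMatching_of_tv` has width `4B·e^{2l₀B}·ρ`).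
* §3 BY NAME: ★ `tiltedMeanMatching_of_shapeSandwich_tanh` ∕ `exists_tiltedMeanMatching_summable_of_shapeSandwich` (n19-c's MEASURE-sandwich SHAPE_cl ⇒ N14's binder
  at the sharp rate `2B·tanh(r∕2)` ∕ summable at the linear rate `B·r`, through §2 + g2's `YMDAG.N14.SharpTilt.tiltedMeanMatching_of_shapeDensity_tanh∕_linear`) ·
  ★ `core_and_tiltedMeanMatching_of_classSandwich` (ONE U3 object — n19-c's class sandwich NE7-S_cl with ONE constant — serves road (iii)'s dressed `NE7.Core`
  (n19-c `core_of_classSandwich` BY NAME) AND N14's binder at `2B·tanh(r∕2)`, on the same good classes).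

HONEST FRAMING.  [folklore] measure theory (Radon–Nikodym, `withDensity`, `Measure.tilted`, products, push-forwards) on a HYPOTHESIS SHAPE: SHAPE_cl is NOT
PRINTED for Bałaban's d = 4 runs and is produced by nobody; ZERO estimate content; nothing of Bałaban's instantiated; N14 NOT discharged (DEPENDENT on §N19 s1 ∕ U3,
№195 (8)); N19 NOT discharged; K3⁷ `SpineGivenEndpointR13SepCoPH` (stmt-QuantumFields-20544) OPEN, NOT claimed — filed `--supports` it `--as helper`; counts UNMOVED
(typed 28∕28 · discharged 5∕27 · A 5∕28).  One finite 𝕋⁴ programme at fixed `ε`; the Yang–Mills mass gap (Clay) is NOT proved by any of this — R4 closes the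
conditional finite-𝕋⁴ rung `BalabanLadder.UV` only; NOT ℝ⁴, NOT OS.  THEOREMS ONLY: 0 `def`; 0 `sorry`; standard axioms; no decl below carries a cite tag.
-/

set_option autoImplicit false

noncomputable section

open MeasureTheory ProbabilityTheory
open scoped ENNReal

namespace YMDAG.N14.ShapeFace

open Summit.QuantumFields.BalabanUV.T4Continuum.NE1p.DressedMGFForm (tiltedMean MGFForm TiltedMeanMatching)
open Summit.QuantumFields.BalabanUV.T4Continuum.Spine.NE7 (Core)

/-! ## §1 One pair of measures: the density form `ν = e^{c}·μ.withDensity e^{g}`, `|g| ≤ r`, and the measure sandwich `e^{c−r}·μ ≤ ν ≤ e^{c+r}·μ` -/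

section OnePair

variable {α : Type*} [MeasurableSpace α] {μ ν ρ : Measure α} {c c₁ c₂ r r₁ r₂ : ℝ}

/-- Scalar monotonicity for measures: `a ≤ b ⇒ a•μ ≤ b•μ`, and `μ ≤ ν ⇒ a•μ ≤ a•ν`. [folklore] -/
theorem smul_le_smul_measure {a b : ℝ≥0∞} (hab : a ≤ b) (hμν : μ ≤ ν) : a • μ ≤ b • ν :=
  Measure.le_iff'.2 fun s => by simpa only [Measure.smul_apply, smul_eq_mul] using mul_le_mul' hab (Measure.le_iff'.1 hμν s)

/-- `ofReal (e^{a}) * ofReal (e^{b}) = ofReal (e^{a+b})`. [folklore] -/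
theorem ofReal_exp_mul_ofReal_exp (a b : ℝ) :
    ENNReal.ofReal (Real.exp a) * ENNReal.ofReal (Real.exp b) = ENNReal.ofReal (Real.exp (a + b)) := by
  rw [← ENNReal.ofReal_mul (Real.exp_pos a).le, Real.exp_add]

/-- **DENSITY FORM ⇒ MEASURE SANDWICH** for one pair (the one-pair reading of n19-c's class-level
`N19ClassSandwichRoad.shapeSandwich_of_shapeDensity`): `ν = e^{c}·μ.withDensity e^{g}` with `|g| ≤ r` gives `e^{c−r}·μ ≤ ν ≤ e^{c+r}·μ` as measures. [folklore] -/
theorem sandwich_of_shapeDensity {g : α → ℝ} (hgb : ∀ x, |g x| ≤ r)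
    (hν : ν = ENNReal.ofReal (Real.exp c) • μ.withDensity fun x => ENNReal.ofReal (Real.exp (g x))) :
    ENNReal.ofReal (Real.exp (c - r)) • μ ≤ ν ∧ ν ≤ ENNReal.ofReal (Real.exp (c + r)) • μ := by
  have hup : (μ.withDensity fun x => ENNReal.ofReal (Real.exp (g x))) ≤ ENNReal.ofReal (Real.exp r) • μ := by
    rw [← withDensity_const]
    exact withDensity_mono (ae_of_all _ fun x => ENNReal.ofReal_le_ofReal (Real.exp_le_exp.2 (abs_le.1 (hgb x)).2))
  have hdn : ENNReal.ofReal (Real.exp (-r)) • μ ≤ μ.withDensity fun x => ENNReal.ofReal (Real.exp (g x)) := by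
    rw [← withDensity_const]
    exact withDensity_mono (ae_of_all _ fun x => ENNReal.ofReal_le_ofReal (Real.exp_le_exp.2 (abs_le.1 (hgb x)).1))
  rw [hν]
  constructor
  · have := smul_le_smul_measure (le_refl (ENNReal.ofReal (Real.exp c))) hdn
    rwa [smul_smul, ofReal_exp_mul_ofReal_exp, ← sub_eq_add_neg] at this
  · have := smul_le_smul_measure (le_refl (ENNReal.ofReal (Real.exp c))) hup
    rwa [smul_smul, ofReal_exp_mul_ofReal_exp] at this

/-- A measure sandwiched from above by a multiple of a finite measure is finite. [folklore] -/
theorem isFiniteMeasure_of_le_smul [IsFiniteMeasure μ] (hhi : ν ≤ ENNReal.ofReal (Real.exp (c + r)) • μ) : IsFiniteMeasure ν :=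
  ⟨(Measure.le_iff'.1 hhi Set.univ).trans_lt (by simpa using ENNReal.mul_lt_top ENNReal.ofReal_lt_top (measure_lt_top μ Set.univ))⟩

/-- **★★ MEASURE SANDWICH ⇒ DENSITY FORM (Radon–Nikodym)** [folklore].  A finite `μ` and a measure `ν` with `e^{c−r}·μ ≤ ν ≤ e^{c+r}·μ` AS MEASURES (`0 ≤ r`)
satisfy `ν = e^{c}·μ.withDensity e^{g}` for a measurable `g` with `|g| ≤ r` EVERYWHERE: `ν ≪ μ`, `dν∕dμ ∈ [e^{c−r}, e^{c+r}]` `μ`-a.e. (set-integral comparison,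
Mathlib `ae_le_of_forall_setLIntegral_le_of_sigmaFinite`), `g := clamp_{[−r,r]}(log(dν∕dμ) − c)`.  Converse of n19-c's `shapeSandwich_of_shapeDensity`, one pair. -/
theorem exists_shapeDensity_of_sandwich [IsFiniteMeasure μ] (hr : 0 ≤ r)
    (hlo : ENNReal.ofReal (Real.exp (c - r)) • μ ≤ ν) (hhi : ν ≤ ENNReal.ofReal (Real.exp (c + r)) • μ) :
    ∃ g : α → ℝ, Measurable g ∧ (∀ x, |g x| ≤ r) ∧
      ν = ENNReal.ofReal (Real.exp c) • μ.withDensity fun x => ENNReal.ofReal (Real.exp (g x)) := by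
  haveI : IsFiniteMeasure ν := isFiniteMeasure_of_le_smul hhi
  have hac : ν ≪ μ := Measure.absolutelyContinuous_of_le_smul hhi
  set f : α → ℝ≥0∞ := ν.rnDeriv μ with hf
  have hfm : Measurable f := Measure.measurable_rnDeriv ν μ
  have hνf : μ.withDensity f = ν := Measure.withDensity_rnDeriv_eq ν μ hac
  have hup : f ≤ᵐ[μ] fun _ => ENNReal.ofReal (Real.exp (c + r)) := by
    refine ae_le_of_forall_setLIntegral_le_of_sigmaFinite hfm fun s _ _ => ?_
    rw [hf, Measure.setLIntegral_rnDeriv hac s, setLIntegral_const]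
    simpa only [Measure.smul_apply, smul_eq_mul] using Measure.le_iff'.1 hhi s
  have hdn : (fun _ => ENNReal.ofReal (Real.exp (c - r))) ≤ᵐ[μ] f := by
    refine ae_le_of_forall_setLIntegral_le_of_sigmaFinite measurable_const fun s _ _ => ?_
    rw [hf, setLIntegral_const, Measure.setLIntegral_rnDeriv hac s]
    simpa only [Measure.smul_apply, smul_eq_mul] using Measure.le_iff'.1 hlo s
  refine ⟨fun x => max (-r) (min r (Real.log (f x).toReal - c)), ?_, ?_, ?_⟩
  · exact measurable_const.max (measurable_const.min ((Real.measurable_log.comp hfm.ennreal_toReal).sub measurable_const))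
  · exact fun x => abs_le.2 ⟨le_max_left _ _, max_le (by linarith) (min_le_left _ _)⟩
  · have hfg : f =ᵐ[μ] fun x => ENNReal.ofReal (Real.exp c) * ENNReal.ofReal (Real.exp (max (-r) (min r (Real.log (f x).toReal - c)))) := by
      filter_upwards [hup, hdn] with x hxu hxd
      have hxT : f x ≠ ⊤ := ne_top_of_le_ne_top ENNReal.ofReal_ne_top hxu
      rw [← ENNReal.ofReal_toReal hxT, ENNReal.ofReal_le_ofReal_iff ENNReal.toReal_nonneg] at hxd
      rw [← ENNReal.ofReal_toReal hxT, ENNReal.ofReal_le_ofReal_iff (Real.exp_pos _).le] at hxu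
      have hpos : 0 < (f x).toReal := lt_of_lt_of_le (Real.exp_pos _) hxd
      have hlog_lo : c - r ≤ Real.log (f x).toReal := by rw [← Real.log_exp (c - r)]; exact Real.log_le_log (Real.exp_pos _) hxd
      have hlog_hi : Real.log (f x).toReal ≤ c + r := by rw [← Real.log_exp (c + r)]; exact Real.log_le_log hpos hxu
      rw [min_eq_right (by linarith), max_eq_right (by linarith), ofReal_exp_mul_ofReal_exp, add_sub_cancel, Real.exp_log hpos,
        ENNReal.ofReal_toReal hxT]
    rw [← hνf, withDensity_congr_ae hfg]
    exact withDensity_smul _ (by fun_prop)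

/-- **SYMMETRY**: the sandwich `μ → ν` (constant `c`, width `r`) IS the sandwich `ν → μ` (constant `−c`, same width). [folklore] -/
theorem sandwich_symm (hlo : ENNReal.ofReal (Real.exp (c - r)) • μ ≤ ν) (hhi : ν ≤ ENNReal.ofReal (Real.exp (c + r)) • μ) :
    ENNReal.ofReal (Real.exp (-c - r)) • ν ≤ μ ∧ μ ≤ ENNReal.ofReal (Real.exp (-c + r)) • ν := by
  constructor
  · have := smul_le_smul_measure (le_refl (ENNReal.ofReal (Real.exp (-c - r)))) hhi
    rwa [smul_smul, ofReal_exp_mul_ofReal_exp, show -c - r + (c + r) = 0 by ring, Real.exp_zero, ENNReal.ofReal_one, one_smul] at this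
  · have := smul_le_smul_measure (le_refl (ENNReal.ofReal (Real.exp (-c + r)))) hlo
    rwa [smul_smul, ofReal_exp_mul_ofReal_exp, show -c + r + (c - r) = 0 by ring, Real.exp_zero, ENNReal.ofReal_one, one_smul] at this

/-- **TRANSITIVITY (widths ADD, constants add)**: `μ → ν` (`c₁`, `r₁`) and `ν → ρ` (`c₂`, `r₂`) compose to `μ → ρ` (`c₁ + c₂`, `r₁ + r₂`). [folklore] -/
theorem sandwich_trans (h₁lo : ENNReal.ofReal (Real.exp (c₁ - r₁)) • μ ≤ ν) (h₁hi : ν ≤ ENNReal.ofReal (Real.exp (c₁ + r₁)) • μ)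
    (h₂lo : ENNReal.ofReal (Real.exp (c₂ - r₂)) • ν ≤ ρ) (h₂hi : ρ ≤ ENNReal.ofReal (Real.exp (c₂ + r₂)) • ν) :
    ENNReal.ofReal (Real.exp (c₁ + c₂ - (r₁ + r₂))) • μ ≤ ρ ∧ ρ ≤ ENNReal.ofReal (Real.exp (c₁ + c₂ + (r₁ + r₂))) • μ := by
  constructor
  · have := smul_le_smul_measure (le_refl (ENNReal.ofReal (Real.exp (c₂ - r₂)))) h₁lo
    rw [smul_smul, ofReal_exp_mul_ofReal_exp, show c₂ - r₂ + (c₁ - r₁) = c₁ + c₂ - (r₁ + r₂) by ring] at this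
    exact this.trans h₂lo
  · have := smul_le_smul_measure (le_refl (ENNReal.ofReal (Real.exp (c₂ + r₂)))) h₁hi
    rw [smul_smul, ofReal_exp_mul_ofReal_exp, show c₂ + r₂ + (c₁ + r₁) = c₁ + c₂ + (r₁ + r₂) by ring] at this
    exact h₂hi.trans this

/-- **TRANSITIVITY IN DENSITY FORM** (`μ`, `ν` finite, widths nonnegative): the composite is again in density form, width `r₁ + r₂`. [folklore] -/
theorem shapeDensity_trans [IsFiniteMeasure μ] (hr₁ : 0 ≤ r₁) (hr₂ : 0 ≤ r₂) {g₁ g₂ : α → ℝ} (hg₁ : ∀ x, |g₁ x| ≤ r₁) (hg₂ : ∀ x, |g₂ x| ≤ r₂)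
    (hν : ν = ENNReal.ofReal (Real.exp c₁) • μ.withDensity fun x => ENNReal.ofReal (Real.exp (g₁ x)))
    (hρ : ρ = ENNReal.ofReal (Real.exp c₂) • ν.withDensity fun x => ENNReal.ofReal (Real.exp (g₂ x))) :
    ∃ g : α → ℝ, Measurable g ∧ (∀ x, |g x| ≤ r₁ + r₂) ∧
      ρ = ENNReal.ofReal (Real.exp (c₁ + c₂)) • μ.withDensity fun x => ENNReal.ofReal (Real.exp (g x)) := by
  obtain ⟨hlo, hhi⟩ := sandwich_trans (sandwich_of_shapeDensity hg₁ hν).1 (sandwich_of_shapeDensity hg₁ hν).2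
    (sandwich_of_shapeDensity hg₂ hρ).1 (sandwich_of_shapeDensity hg₂ hρ).2
  exact exists_shapeDensity_of_sandwich (by linarith) hlo hhi

/-- **SYMMETRY IN DENSITY FORM** (`μ` finite, `0 ≤ r`): `μ = e^{−c}·ν.withDensity e^{g′}` with `|g′| ≤ r`. [folklore] -/
theorem shapeDensity_symm [IsFiniteMeasure μ] (hr : 0 ≤ r) {g : α → ℝ} (hgb : ∀ x, |g x| ≤ r)
    (hν : ν = ENNReal.ofReal (Real.exp c) • μ.withDensity fun x => ENNReal.ofReal (Real.exp (g x))) :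
    ∃ g' : α → ℝ, Measurable g' ∧ (∀ x, |g' x| ≤ r) ∧
      μ = ENNReal.ofReal (Real.exp (-c)) • ν.withDensity fun x => ENNReal.ofReal (Real.exp (g' x)) := by
  obtain ⟨hlo, hhi⟩ := sandwich_of_shapeDensity hgb hν
  haveI : IsFiniteMeasure ν := isFiniteMeasure_of_le_smul hhi
  exact exists_shapeDensity_of_sandwich (c := -c) hr (sandwich_symm hlo hhi).1 (sandwich_symm hlo hhi).2

/-! ### Tilt-invariance: the SAME log-density serves every tilted pair -/

/-- **★ TILT-INVARIANCE OF THE DENSITY FORM** [folklore].  `ν = e^{c}·μ.withDensity e^{g}` (`μ` finite non-zero, `g` measurable, `|g| ≤ r`) ⇒ for every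
measurable `f` with `e^{f}` `μ`-integrable: `ν.tilted f = e^{c′}·(μ.tilted f).withDensity e^{g}` with the SAME `g`, `c′ = log ∫e^{f}dμ + c − log ∫e^{f}dν`,
`|c′| ≤ r` (probability laws: the constant is pinned within the width).  N14's use: `f = s·W` — the U3 face is inherited by ALL source-tilted class laws. -/
theorem shapeDensity_tilted [IsFiniteMeasure μ] [NeZero μ] {g : α → ℝ} (hgm : Measurable g) (hgb : ∀ x, |g x| ≤ r)
    (hν : ν = ENNReal.ofReal (Real.exp c) • μ.withDensity fun x => ENNReal.ofReal (Real.exp (g x)))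
    {f : α → ℝ} (hfm : Measurable f) (hfi : Integrable (fun x => Real.exp (f x)) μ) :
    ∃ c' : ℝ, |c'| ≤ r ∧
      ν.tilted f = ENNReal.ofReal (Real.exp c') • (μ.tilted f).withDensity fun x => ENNReal.ofReal (Real.exp (g x)) := by
  obtain ⟨hlo, hhi⟩ := sandwich_of_shapeDensity hgb hν
  haveI : IsFiniteMeasure ν := isFiniteMeasure_of_le_smul hhi
  set Zμ : ℝ := ∫ x, Real.exp (f x) ∂μ with hZμ
  set Zν : ℝ := ∫ x, Real.exp (f x) ∂ν with hZν
  have hZμpos : 0 < Zμ := integral_exp_pos hfi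
  have hfiν : Integrable (fun x => Real.exp (f x)) ν := Integrable.of_measure_le_smul ENNReal.ofReal_ne_top hhi hfi
  obtain ⟨hZlo, hZhi⟩ :=
    Summit.QuantumFields.YangMills.BalabanUVNodes.N19ClassSandwichRoad.integral_measure_sandwich hlo hhi (Real.exp_pos _).le
      (Real.exp_pos _).le (fun x => (Real.exp_pos (f x)).le) hfi hfiν
  have hZνpos : 0 < Zν := lt_of_lt_of_le (mul_pos (Real.exp_pos _) hZμpos) hZlo
  refine ⟨Real.log Zμ + c - Real.log Zν, ?_, ?_⟩
  · have h1 : Real.log Zν ≤ c + r + Real.log Zμ := by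
      have := Real.log_le_log hZνpos hZhi
      rwa [Real.log_mul (Real.exp_pos _).ne' hZμpos.ne', Real.log_exp] at this
    have h2 : c - r + Real.log Zμ ≤ Real.log Zν := by
      have := Real.log_le_log (mul_pos (Real.exp_pos _) hZμpos) hZlo
      rwa [Real.log_mul (Real.exp_pos _).ne' hZμpos.ne', Real.log_exp] at this
    exact abs_le.2 ⟨by linarith, by linarith⟩
  · have hG : Measurable fun x => ENNReal.ofReal (Real.exp (g x)) := by fun_prop
    have hHμ : Measurable fun x => ENNReal.ofReal (Real.exp (f x) / Zμ) := by fun_prop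
    have hkey : (fun x => ENNReal.ofReal (Real.exp (g x))) * (fun x => ENNReal.ofReal (Real.exp (f x) / Zν))
        = ENNReal.ofReal (Zμ / Zν) • ((fun x => ENNReal.ofReal (Real.exp (f x) / Zμ)) * fun x => ENNReal.ofReal (Real.exp (g x))) := by
      funext x; simp only [Pi.mul_apply, Pi.smul_apply, smul_eq_mul]
      rw [mul_comm (ENNReal.ofReal (Real.exp (g x))), ← mul_assoc, ← ENNReal.ofReal_mul (div_pos hZμpos hZνpos).le]
      congr 2; field_simp
    have hconst : ENNReal.ofReal (Real.exp c) * ENNReal.ofReal (Zμ / Zν) = ENNReal.ofReal (Real.exp (Real.log Zμ + c - Real.log Zν)) := by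
      rw [← ENNReal.ofReal_mul (Real.exp_pos c).le, show Real.log Zμ + c - Real.log Zν = c + (Real.log Zμ - Real.log Zν) by ring,
        Real.exp_add, Real.exp_sub, Real.exp_log hZμpos, Real.exp_log hZνpos]
    calc ν.tilted f
        = ν.withDensity (fun x => ENNReal.ofReal (Real.exp (f x) / Zν)) := rfl
      _ = ENNReal.ofReal (Real.exp c) • (μ.withDensity fun x => ENNReal.ofReal (Real.exp (g x))).withDensity
            (fun x => ENNReal.ofReal (Real.exp (f x) / Zν)) := by rw [hν, withDensity_smul_measure]
      _ = ENNReal.ofReal (Real.exp c) • μ.withDensity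
            ((fun x => ENNReal.ofReal (Real.exp (g x))) * fun x => ENNReal.ofReal (Real.exp (f x) / Zν)) := by
          rw [withDensity_mul _ hG (by fun_prop)]
      _ = ENNReal.ofReal (Real.exp c) • (ENNReal.ofReal (Zμ / Zν) •
            μ.withDensity ((fun x => ENNReal.ofReal (Real.exp (f x) / Zμ)) * fun x => ENNReal.ofReal (Real.exp (g x)))) := by
          rw [hkey, withDensity_smul _ (hHμ.mul hG)]
      _ = ENNReal.ofReal (Real.exp (Real.log Zμ + c - Real.log Zν)) •
            (μ.tilted f).withDensity fun x => ENNReal.ofReal (Real.exp (g x)) := by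
          rw [smul_smul, hconst, withDensity_mul _ hHμ hG]; rfl

/-- **TILT-INVARIANCE OF THE MEASURE SANDWICH** [folklore]: `e^{c−r}·μ ≤ ν ≤ e^{c+r}·μ` (`μ` finite, `0 ≤ r`), `f` measurable with `e^{f}` `μ`-integrable ⇒
`e^{c′−r}·μ.tilted f ≤ ν.tilted f ≤ e^{c′+r}·μ.tilted f` with `|c′| ≤ r`. -/
theorem sandwich_tilted [IsFiniteMeasure μ] (hr : 0 ≤ r)
    (hlo : ENNReal.ofReal (Real.exp (c - r)) • μ ≤ ν) (hhi : ν ≤ ENNReal.ofReal (Real.exp (c + r)) • μ)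
    {f : α → ℝ} (hfm : Measurable f) (hfi : Integrable (fun x => Real.exp (f x)) μ) :
    ∃ c' : ℝ, |c'| ≤ r ∧ ENNReal.ofReal (Real.exp (c' - r)) • μ.tilted f ≤ ν.tilted f ∧
      ν.tilted f ≤ ENNReal.ofReal (Real.exp (c' + r)) • μ.tilted f := by
  rcases eq_zero_or_neZero μ with h0 | hne
  · have hν0 : ν = 0 := le_antisymm (hhi.trans (by rw [h0, smul_zero])) (Measure.zero_le _)
    refine ⟨0, by rw [abs_zero]; exact hr, ?_, ?_⟩ <;> simp [h0, hν0]
  · obtain ⟨g, hgm, hgb, hν⟩ := exists_shapeDensity_of_sandwich hr hlo hhi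
    obtain ⟨c', hc', htilt⟩ := shapeDensity_tilted hgm hgb hν hfm hfi
    exact ⟨c', hc', sandwich_of_shapeDensity hgb htilt⟩

/-- **THE TILTED PROBABILITY LAWS ARE `e^{∓2r}`-COMPARABLE WITH NO CONSTANT** [folklore] (n19-c's «normalised class laws are `e^{±2r}`-comparable», for every tilt):
`e^{−2r}·μ.tilted f ≤ ν.tilted f ≤ e^{2r}·μ.tilted f`. -/
theorem sandwich_tilted_two_mul [IsFiniteMeasure μ] (hr : 0 ≤ r)
    (hlo : ENNReal.ofReal (Real.exp (c - r)) • μ ≤ ν) (hhi : ν ≤ ENNReal.ofReal (Real.exp (c + r)) • μ)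
    {f : α → ℝ} (hfm : Measurable f) (hfi : Integrable (fun x => Real.exp (f x)) μ) :
    ENNReal.ofReal (Real.exp (-(2 * r))) • μ.tilted f ≤ ν.tilted f ∧ ν.tilted f ≤ ENNReal.ofReal (Real.exp (2 * r)) • μ.tilted f := by
  obtain ⟨c', hc', hlo', hhi'⟩ := sandwich_tilted hr hlo hhi hfm hfi
  obtain ⟨h1, h2⟩ := abs_le.1 hc'
  exact ⟨(smul_le_smul_measure (ENNReal.ofReal_le_ofReal (Real.exp_le_exp.2 (by linarith))) le_rfl).trans hlo',
    hhi'.trans (smul_le_smul_measure (ENNReal.ofReal_le_ofReal (Real.exp_le_exp.2 (by linarith))) le_rfl)⟩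

/-! ### Push-forwards and products -/

/-- **PUSH-FORWARD STABILITY** [folklore] (one pair; cf. n19-c's class-level `classSandwich_map`): same constant and width along any measurable map. -/
theorem sandwich_map {β : Type*} [MeasurableSpace β] {a : α → β} (ha : Measurable a)
    (hlo : ENNReal.ofReal (Real.exp (c - r)) • μ ≤ ν) (hhi : ν ≤ ENNReal.ofReal (Real.exp (c + r)) • μ) :
    ENNReal.ofReal (Real.exp (c - r)) • μ.map a ≤ ν.map a ∧ ν.map a ≤ ENNReal.ofReal (Real.exp (c + r)) • μ.map a :=
  ⟨by simpa only [Measure.map_smul] using Measure.map_mono hlo ha, by simpa only [Measure.map_smul] using Measure.map_mono hhi ha⟩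

/-- **PUSH-FORWARD STABILITY IN DENSITY FORM** [folklore]: the image pair is again in density form with the same width (Radon–Nikodym on the image). -/
theorem shapeDensity_map [IsFiniteMeasure μ] (hr : 0 ≤ r) {β : Type*} [MeasurableSpace β] {a : α → β} (ha : Measurable a)
    {g : α → ℝ} (hgb : ∀ x, |g x| ≤ r) (hν : ν = ENNReal.ofReal (Real.exp c) • μ.withDensity fun x => ENNReal.ofReal (Real.exp (g x))) :
    ∃ g' : β → ℝ, Measurable g' ∧ (∀ y, |g' y| ≤ r) ∧
      ν.map a = ENNReal.ofReal (Real.exp c) • (μ.map a).withDensity fun y => ENNReal.ofReal (Real.exp (g' y)) := by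
  obtain ⟨hlo, hhi⟩ := sandwich_of_shapeDensity hgb hν
  haveI : IsFiniteMeasure (μ.map a) := Measure.isFiniteMeasure_map μ a
  exact exists_shapeDensity_of_sandwich hr (sandwich_map ha hlo hhi).1 (sandwich_map ha hlo hhi).2

/-- **BLOCK PRODUCTS (widths ADD)** [folklore]: two pairs in density form on independent blocks give the product pair in density form, log-density
`g₁(x) + g₂(y)`, constant `c₁ + c₂`, width `r₁ + r₂` (Mathlib `prod_withDensity`) — the exact-independence skeleton of the extensivity of the U3 face. -/
theorem shapeDensity_prod {β : Type*} [MeasurableSpace β] {μ₁ ν₁ : Measure α} {μ₂ ν₂ : Measure β} [SFinite μ₁] [SFinite μ₂]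
    {g₁ : α → ℝ} {g₂ : β → ℝ} (hg₁m : Measurable g₁) (hg₂m : Measurable g₂) (hg₁ : ∀ x, |g₁ x| ≤ r₁) (hg₂ : ∀ y, |g₂ y| ≤ r₂)
    (hν₁ : ν₁ = ENNReal.ofReal (Real.exp c₁) • μ₁.withDensity fun x => ENNReal.ofReal (Real.exp (g₁ x)))
    (hν₂ : ν₂ = ENNReal.ofReal (Real.exp c₂) • μ₂.withDensity fun y => ENNReal.ofReal (Real.exp (g₂ y))) :
    (Measurable fun z : α × β => g₁ z.1 + g₂ z.2) ∧ (∀ z : α × β, |g₁ z.1 + g₂ z.2| ≤ r₁ + r₂) ∧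
      ν₁.prod ν₂ = ENNReal.ofReal (Real.exp (c₁ + c₂)) •
        (μ₁.prod μ₂).withDensity fun z => ENNReal.ofReal (Real.exp (g₁ z.1 + g₂ z.2)) := by
  refine ⟨by fun_prop, fun z => (abs_add_le _ _).trans (add_le_add (hg₁ z.1) (hg₂ z.2)), ?_⟩
  rw [hν₁, hν₂, Measure.prod_smul_left, Measure.prod_smul_right, smul_smul, ofReal_exp_mul_ofReal_exp,
    prod_withDensity (by fun_prop) (by fun_prop)]
  congr 1
  refine withDensity_congr_ae (ae_of_all _ fun z => ?_)
  show ENNReal.ofReal (Real.exp (g₁ z.1)) * ENNReal.ofReal (Real.exp (g₂ z.2)) = ENNReal.ofReal (Real.exp (g₁ z.1 + g₂ z.2))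
  rw [ofReal_exp_mul_ofReal_exp]

end OnePair

/-! ## §2 Class level: n19-c's SHAPE_cl measure sandwich ⟺ the density form, on every good class -/

section ClassLevel

variable {ι : Type*} [DecidableEq ι] {Ω : ℕ → Type*} [∀ K, MeasurableSpace (Ω K)]
  {l₀ B : ℝ} {T : ℕ → Finset ι} {Bad : ℕ → ℝ → Finset ι} {W : ∀ K, Ω K → ℝ}
  {μA μB μC : ∀ K, ι → Measure (Ω K)} {r r₁ r₂ : ℕ → ℝ}

/-- **★ SHAPE_cl AS A MEASURE SANDWICH ⇒ SHAPE_cl IN DENSITY FORM** [folklore] — the converse of n19-c's `N19ClassSandwichRoad.shapeSandwich_of_shapeDensity`, with its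
binder prefixes VERBATIM (run A's class pieces finite, widths nonnegative): the U3 face of road (iii) (per-class MEASURE sandwich) IS n19-w2's density-form face
`hSh`∕`hD` that N14's binder is produced from (Radon–Nikodym, §1). -/
theorem shapeDensity_of_shapeSandwich (hfin : ∀ K, ∀ τ ∈ T K, IsFiniteMeasure (μA K τ)) (hr : ∀ K, 0 ≤ r K)
    (hSh : ∀ (K : ℕ) (t : ℝ), |t| ≤ l₀ → ∀ τ ∈ T K \ Bad K t, ∃ c : ℝ,
      ENNReal.ofReal (Real.exp (c - r K)) • μA K τ ≤ μB K τ ∧ μB K τ ≤ ENNReal.ofReal (Real.exp (c + r K)) • μA K τ) :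
    ∀ (K : ℕ) (t : ℝ), |t| ≤ l₀ → ∀ τ ∈ T K \ Bad K t, ∃ (c : ℝ) (g : Ω K → ℝ), Measurable g ∧ (∀ ω, |g ω| ≤ r K) ∧
      μB K τ = ENNReal.ofReal (Real.exp c) • (μA K τ).withDensity fun ω => ENNReal.ofReal (Real.exp (g ω)) := by
  intro K t ht τ hτ
  haveI := hfin K τ (Finset.mem_sdiff.mp hτ).1
  obtain ⟨c, hlo, hhi⟩ := hSh K t ht τ hτ
  exact ⟨c, exists_shapeDensity_of_sandwich (hr K) hlo hhi⟩

/-- **SHAPE_cl: MEASURE SANDWICH ⟺ DENSITY FORM** at the class level (run A's class pieces finite, widths nonnegative). [folklore] -/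
theorem shapeSandwich_iff_shapeDensity (hfin : ∀ K, ∀ τ ∈ T K, IsFiniteMeasure (μA K τ)) (hr : ∀ K, 0 ≤ r K) :
    (∀ (K : ℕ) (t : ℝ), |t| ≤ l₀ → ∀ τ ∈ T K \ Bad K t, ∃ c : ℝ,
      ENNReal.ofReal (Real.exp (c - r K)) • μA K τ ≤ μB K τ ∧ μB K τ ≤ ENNReal.ofReal (Real.exp (c + r K)) • μA K τ) ↔
    (∀ (K : ℕ) (t : ℝ), |t| ≤ l₀ → ∀ τ ∈ T K \ Bad K t, ∃ (c : ℝ) (g : Ω K → ℝ), Measurable g ∧ (∀ ω, |g ω| ≤ r K) ∧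
      μB K τ = ENNReal.ofReal (Real.exp c) • (μA K τ).withDensity fun ω => ENNReal.ofReal (Real.exp (g ω))) :=
  ⟨shapeDensity_of_shapeSandwich hfin hr,
    Summit.QuantumFields.YangMills.BalabanUVNodes.N19ClassSandwichRoad.shapeSandwich_of_shapeDensity⟩

/-- **SHAPE_cl IS SYMMETRIC IN THE TWO RUNS** (same width, per-class constant negated). [folklore] -/
theorem shapeSandwich_symm
    (hSh : ∀ (K : ℕ) (t : ℝ), |t| ≤ l₀ → ∀ τ ∈ T K \ Bad K t, ∃ c : ℝ,
      ENNReal.ofReal (Real.exp (c - r K)) • μA K τ ≤ μB K τ ∧ μB K τ ≤ ENNReal.ofReal (Real.exp (c + r K)) • μA K τ) :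
    ∀ (K : ℕ) (t : ℝ), |t| ≤ l₀ → ∀ τ ∈ T K \ Bad K t, ∃ c : ℝ,
      ENNReal.ofReal (Real.exp (c - r K)) • μB K τ ≤ μA K τ ∧ μA K τ ≤ ENNReal.ofReal (Real.exp (c + r K)) • μB K τ := by
  intro K t ht τ hτ
  obtain ⟨c, hlo, hhi⟩ := hSh K t ht τ hτ
  exact ⟨-c, sandwich_symm hlo hhi⟩

/-- **SHAPE_cl IS TRANSITIVE ALONG RUNS (widths ADD)**: run A vs run B at width `r₁` and run B vs run C at width `r₂`, on the same good classes, give run A vs run C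
at width `r₁ + r₂`. [folklore] -/
theorem shapeSandwich_trans
    (h₁ : ∀ (K : ℕ) (t : ℝ), |t| ≤ l₀ → ∀ τ ∈ T K \ Bad K t, ∃ c : ℝ,
      ENNReal.ofReal (Real.exp (c - r₁ K)) • μA K τ ≤ μB K τ ∧ μB K τ ≤ ENNReal.ofReal (Real.exp (c + r₁ K)) • μA K τ)
    (h₂ : ∀ (K : ℕ) (t : ℝ), |t| ≤ l₀ → ∀ τ ∈ T K \ Bad K t, ∃ c : ℝ,
      ENNReal.ofReal (Real.exp (c - r₂ K)) • μB K τ ≤ μC K τ ∧ μC K τ ≤ ENNReal.ofReal (Real.exp (c + r₂ K)) • μB K τ) :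
    ∀ (K : ℕ) (t : ℝ), |t| ≤ l₀ → ∀ τ ∈ T K \ Bad K t, ∃ c : ℝ,
      ENNReal.ofReal (Real.exp (c - (r₁ K + r₂ K))) • μA K τ ≤ μC K τ ∧
        μC K τ ≤ ENNReal.ofReal (Real.exp (c + (r₁ K + r₂ K))) • μA K τ := by
  intro K t ht τ hτ
  obtain ⟨c₁, h₁lo, h₁hi⟩ := h₁ K t ht τ hτ
  obtain ⟨c₂, h₂lo, h₂hi⟩ := h₂ K t ht τ hτ
  exact ⟨c₁ + c₂, sandwich_trans h₁lo h₁hi h₂lo h₂hi⟩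

/-- **★ THE U3 FACE IS INHERITED BY THE SOURCE-TILTED CLASS LAWS** [folklore]: SHAPE_cl at width `r` between the two runs' class pieces (run A's finite, `W K`
measurable and bounded) gives, for EVERY real tilt `s` (no window needed), SHAPE_cl at the SAME width between the tilted class laws `(μA K τ).tilted (s·W K)` and
`(μB K τ).tilted (s·W K)`, with per-class constants `|c′| ≤ r K`.  This is the located reason the U3 face serves N14's TILTED binder `TiltedMeanMatching` uniformly
in `|s| ≤ l₀` at a tilt-free rate (g2's `abs_tiltedMean_tilted_sub_le_tanh` reads exactly this), whereas the TV currency pays the tilt with `e^{2l₀B}` (n19-c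
`N19CoreTVInvariant.tiltedMeanMatching_of_tv`, width `4B·e^{2l₀B}·ρ`; TV_cl is NOT tilt-stable). -/
theorem shapeSandwich_tilted (hfin : ∀ K, ∀ τ ∈ T K, IsFiniteMeasure (μA K τ)) (hr : ∀ K, 0 ≤ r K)
    (hWm : ∀ K, Measurable (W K)) (hWb : ∀ K ω, |W K ω| ≤ B)
    (hSh : ∀ (K : ℕ) (t : ℝ), |t| ≤ l₀ → ∀ τ ∈ T K \ Bad K t, ∃ c : ℝ,
      ENNReal.ofReal (Real.exp (c - r K)) • μA K τ ≤ μB K τ ∧ μB K τ ≤ ENNReal.ofReal (Real.exp (c + r K)) • μA K τ) (s : ℝ) :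
    ∀ (K : ℕ) (t : ℝ), |t| ≤ l₀ → ∀ τ ∈ T K \ Bad K t, ∃ c : ℝ, |c| ≤ r K ∧
      ENNReal.ofReal (Real.exp (c - r K)) • (μA K τ).tilted (fun ω => s * W K ω) ≤ (μB K τ).tilted (fun ω => s * W K ω) ∧
        (μB K τ).tilted (fun ω => s * W K ω) ≤ ENNReal.ofReal (Real.exp (c + r K)) • (μA K τ).tilted (fun ω => s * W K ω) := by
  intro K t ht τ hτ
  haveI := hfin K τ (Finset.mem_sdiff.mp hτ).1
  obtain ⟨c, hlo, hhi⟩ := hSh K t ht τ hτ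
  exact sandwich_tilted (hr K) hlo hhi ((hWm K).const_mul s)
    (Literature.MathematicalPhysics.QuantumFieldTheory.Balaban1983to89.T4GenFunBounds.integrable_exp_mul_of_bound
      (hWm K).aemeasurable (ae_of_all _ (hWb K)) s)

end ClassLevel

/-! ## §3 By name: n19-c's MEASURE-sandwich SHAPE_cl gives N14's binder at the sharp rate; ONE U3 object serves `NE7.Core` AND the binder -/

section Binder

variable {ι : Type*} [DecidableEq ι] {Ω : ℕ → Type*} [∀ K, MeasurableSpace (Ω K)]
  {l₀ vol B : ℝ} {T : ℕ → Finset ι} {Bad : ℕ → ℝ → Finset ι} {W : ∀ K, Ω K → ℝ}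
  {μA μB : ∀ K, ι → Measure (Ω K)} {P Q : ℕ → ℝ → ι → ℝ} {r δ : ℕ → ℝ}

/-- **★ SHAPE_cl AS A MEASURE SANDWICH ⇒ N14's BINDER AT THE SHARP RATE `2B·tanh(r∕2)`** [folklore]: §2 `shapeDensity_of_shapeSandwich` followed by g2's
`YMDAG.N14.SharpTilt.tiltedMeanMatching_of_shapeDensity_tanh` (binder prefixes VERBATIM). -/
theorem tiltedMeanMatching_of_shapeSandwich_tanh (hfin : ∀ K, ∀ τ ∈ T K, IsFiniteMeasure (μA K τ)) (hr : ∀ K, 0 ≤ r K) (hB : 0 ≤ B)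
    (hWm : ∀ K, Measurable (W K)) (hWb : ∀ K ω, |W K ω| ≤ B)
    (hSh : ∀ (K : ℕ) (t : ℝ), |t| ≤ l₀ → ∀ τ ∈ T K \ Bad K t, ∃ c : ℝ,
      ENNReal.ofReal (Real.exp (c - r K)) • μA K τ ≤ μB K τ ∧ μB K τ ≤ ENNReal.ofReal (Real.exp (c + r K)) • μA K τ) :
    TiltedMeanMatching l₀ T Bad W μA W μB fun K => 2 * B * Real.tanh (r K / 2) :=
  YMDAG.N14.SharpTilt.tiltedMeanMatching_of_shapeDensity_tanh (shapeDensity_of_shapeSandwich hfin hr hSh) hr hB hfin hWm hWb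

/-- **THE (I)-SLOT SHAPE `∃ η, TiltedMeanMatching … η ∧ Summable η`** from the MEASURE-sandwich SHAPE_cl with summable widths, at the LINEAR rate `η := B·r`
(g2's `tiltedMeanMatching_of_shapeDensity_linear` BY NAME). [folklore] -/
theorem exists_tiltedMeanMatching_summable_of_shapeSandwich (hfin : ∀ K, ∀ τ ∈ T K, IsFiniteMeasure (μA K τ)) (hr : ∀ K, 0 ≤ r K)
    (hrs : Summable r) (hB : 0 ≤ B) (hWm : ∀ K, Measurable (W K)) (hWb : ∀ K ω, |W K ω| ≤ B)
    (hSh : ∀ (K : ℕ) (t : ℝ), |t| ≤ l₀ → ∀ τ ∈ T K \ Bad K t, ∃ c : ℝ,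
      ENNReal.ofReal (Real.exp (c - r K)) • μA K τ ≤ μB K τ ∧ μB K τ ≤ ENNReal.ofReal (Real.exp (c + r K)) • μA K τ) :
    ∃ η : ℕ → ℝ, TiltedMeanMatching l₀ T Bad W μA W μB η ∧ Summable η :=
  ⟨fun K => B * r K, YMDAG.N14.SharpTilt.tiltedMeanMatching_of_shapeDensity_linear (shapeDensity_of_shapeSandwich hfin hr hSh)
    hr hB hfin hWm hWb, hrs.mul_left B⟩

/-- **★ ONE U3 OBJECT SERVES BOTH CONSUMERS** [folklore]: n19-c's class-level measure sandwich NE7-S_cl with ONE constant per `K` (width `r K`, run A's class pieces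
the finite measures of an MGF form) gives, on the same good classes, BOTH road (iii)'s dressed `Spine.NE7.Core l₀ vol T Bad P Q δ` for any `vol·δ K ≥ r K`
(n19-c `core_of_classSandwich` BY NAME) AND N14's binder `TiltedMeanMatching l₀ T Bad W μA W μB (K ↦ 2B·tanh(r K∕2))` (via `shapeSandwich_of_classSandwich` + §3). -/
theorem core_and_tiltedMeanMatching_of_classSandwich (hP : MGFForm B T W μA P) (hQ : MGFForm B T W μB Q) (hr : ∀ K, 0 ≤ r K)
    (hS : ∀ K : ℕ, ∃ c : ℝ, ∀ t : ℝ, |t| ≤ l₀ → ∀ τ ∈ T K \ Bad K t,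
      ENNReal.ofReal (Real.exp (c - r K)) • μA K τ ≤ μB K τ ∧ μB K τ ≤ ENNReal.ofReal (Real.exp (c + r K)) • μA K τ)
    (hrδ : ∀ K, r K ≤ vol * δ K) :
    Core l₀ vol T Bad P Q δ ∧ TiltedMeanMatching l₀ T Bad W μA W μB fun K => 2 * B * Real.tanh (r K / 2) :=
  ⟨Summit.QuantumFields.YangMills.BalabanUVNodes.N19ClassSandwichRoad.core_of_classSandwich hP hQ hS hrδ,
    tiltedMeanMatching_of_shapeSandwich_tanh hP.finite hr hP.nonneg hP.meas hP.bound
      (Summit.QuantumFields.YangMills.BalabanUVNodes.N19ClassSandwichRoad.shapeSandwich_of_classSandwich hS)⟩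

end Binder

end YMDAG.N14.ShapeFace

end
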